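import Summits.QuantumFields.BalabanUV.Beta.FP.HorizontalBookkeeping
import Summits.QuantumFields.BalabanUV.Beta.FP.TransportProfileMoments
import Summits.QuantumFields.BalabanUV.Beta.FP.LatticeTaylorPath

/-!
# `BalabanUV.Beta.FP.HorizontalBookkeepingTail` — road «FP», N7 H-route, row H3-BOOK (b-T): THE SCALAR ENGINE OF THE TAIL TRANSPORT COMPARISON —
# dressed sums with a BOUNDED middle factor (no moment of it), the centred form, the unified near/far difference bound, the profile letters at the
# transport scale `δ/N`, and the tail kernel `K − truncK K N` on `ℤ⁴` ([folklore] lattice bookkeeping; nothing of the manuscripts)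

HONEST DEPENDENCY (page 1, mandatory): continuum YM on T⁴ ⇐ BetaPertH ∧ nine spine estimates (0/9 proved); BetaPertH ⇐ (D1) ∧ (D4) ∧
CAP+tail; G-an2-4 gates asym, D1 and NE2/3/4.  HONEST FRAMING (cell contract, verbatim): «discharging `BetaPertH` makes Bałaban's UV
stability UNCONDITIONAL — a real constructive-QFT result; it is NOT the continuum limit and NOT the Clay problem.»  THIS MODULE is elementary [folklore]
real analysis on `ℤ^D` composed BY NAME from the tree: `DecimatedMomentSummable.dressedSum`, `DressedMomentNormalisation.dressedEntry`/`EKer`,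
`FP/LatticeTaylorPath.abs_taylor0D_le` (order-zero Taylor along the coordinate path), `FP/StencilMoments.summable_of_weight_exp` via
`FP/TransportProfileMoments`, `FP/HorizontalBookkeeping.truncK` (leaf-02 gen 5's sup-norm truncation), `DyadicShell.supNorm`.  It cites nothing, defines
nothing (the tail kernel is the term `K - truncK K N`), mints no `Prop` fact, 0 sorry.  NOT the kernel-level comparison (next module `…TailPointwise`), NOT the summed
form, NOT (H3-b)'s assembly (leaf-05's (b3′)/(b4′)), NOT `hbook`, NOT `hasym`, NOT D1, NOT BetaPertH, NOT continuum, NOT Clay.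

ROW (road FP owner d1-p3-g4, R-FP-15 ∕ `N7-PROOF.v2.md` §3 (H3-b), `LEAVES-FP.md` sub-row «H3-BOOK (b-T)», split with leaf-05-g8 agreed CLAIMS.log
2026-08-20 ≈17:58Z): the TRANSPORT COMPARISON AGAINST THE RESCALED TAIL KERNEL `Q_N a b v := N⁶·(K − truncK K N) a b (N•v)`.  DESIGN (finding shared with
leaf-05's F-d1leaf05g8-1): with DECAY-ONLY hypotheses on `K` the honest comparison kernel is `Q_N`, not `K(v)`; ORDER-ZERO Taylor with a FIRST-difference
remainder suffices because `‖v‖∞⁻⁷` IS summable against `v_μv_ν` on `ℤ⁴` (shell count `r³·r²·r⁻⁷ = r⁻²`); the zeroth-order term is EXACT by the total masses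
`Σ_x w κ l x = δ_{κl}·N⁻¹`; the far region is `N`-uniform because `sup|K − truncK K N| ≤ C·(N+1)⁻⁶`.

CONTENT.
* §1 `summable_dressed_fibre_of_bounded` (fibres summable for BOUNDED `T` and absolutely summable patterns — the tail of a `‖z‖⁻⁶` kernel has NO absolute
  second moment in `d = 4`, so `DecimatedMomentSummable.summable_dressed_fibre` does not apply), `dressedSum_sub` (linearity in `T`), `hasSum_abs_mul_abs`,
  `hasSum_mul`, `dressedSum_sub_centre` (`dressedSum w T w' y − T y·(Σ'w)(Σ'w') = Σ'_{(u,x)} w u·(T (y+u−x) − T y)·w' x`).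
* §2 `abs_sub_le_near_far` (**the unified near/far bound** `|F (y+s) − F y| ≤ D·B·|s|₁ + 2A·(|s|₁/ρ)⁷` from `|F| ≤ A` and first differences `≤ B` on the
  coordinate box of radius `ρ` around `y`), `abs_sub_le_letters`, `hasSum_majorant`, and **`abs_dressedSum_sub_centre_le`**:
  `|dressedSum w T w' y − T y·(Σ'w)(Σ'w')| ≤ D·B·(P₁Q₀ + P₀Q₁) + 128·A·ρ⁻⁷·(P₇Q₀ + P₀Q₇)` with the profile letters `P_k := Σ'_u (|u|₁+1)^k|w u|`,
  `Q_k := Σ'_x (|x|₁+1)^k|w' x|`.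
* §3 `letter_at_scale`: `|w x| ≤ c·e^{−(δ/N)|x|₁}` ⟹ `Σ'_x (|x|₁+1)^k|w x| ≤ c·(k!·e^{δ/2}·(2/δ)^k·(1+4/δ)^D)·N^{k+D}` (general `k`; g5's `letters_at_scale` is
  `k ≤ 2`).
* §4 (`d = 4`) `supNorm_natCast_smul` (`‖N•v‖∞ = N‖v‖∞`), `supNorm_le_add_of_box`, `single_mem_corners`, the TAIL KERNEL `K − truncK K N`: `tail_apply`,
  `tail_eq_of_lt`, `tail_eq_zero_of_le`, `truncK_add_tail`, `nonneg_of_decay`, **`abs_tail_le`** (`≤ C·(N+1)⁻⁶` everywhere), **`abs_tail_diff_le`** (first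
  differences `≤ C·(‖t‖∞+1)⁻⁷` for `‖t‖∞ ≥ N+2`).
Unit `b2b-balaban-beta-d1-formalise-leaf-02` (gen 6).
-/

noncomputable section

namespace Summit.QuantumFields.BalabanUV.Beta.FP.HorizontalBookkeepingTail

open Finset Filter Topology
open scoped BigOperators
open Literature.MathematicalPhysics.QuantumFieldTheory.Balaban1983to89
open Literature.MathematicalPhysics.QuantumFieldTheory.Balaban1983to89.Beta
open B12Sec2to5 (l1 l1_nonneg abs_coord_le_l1)
open ExpKernelCalculus (Site Zl Zl_pos l1_sub_triangle l1_sub_symm)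
open DecimatedMomentSummable (dressedSum ConstReproSum)
open DressedMomentNormalisation (EKer dressedEntry hasSum_total_of_constReproSum)
open Summit.QuantumFields.BalabanUV.Beta.FP.StencilMoments (summable_of_weight_exp)
open Summit.QuantumFields.BalabanUV.Beta.FP.LatticeTaylorPath (abs_taylor0D_le)
open Summit.QuantumFields.BalabanUV.Beta.FP.HorizontalBookkeeping (truncK truncK_apply)

variable {D : ℕ}

/-! ## §1 Scalar dressed sums with a bounded middle factor: summable fibres, linearity, the centred form -/

/-- [folklore] The fibre `(u, x) ↦ w u · T (y + u − x) · w' x` of the dressed sum is summable as soon as `T` is BOUNDED and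
`|w|`, `|w'|` are summable (no moment condition on `T` — the tail of a `‖z‖⁻⁶` kernel has no absolute second moment in `d = 4`). -/
theorem summable_dressed_fibre_of_bounded {w T w' : Site D → ℝ} {A : ℝ} (hw : Summable fun u => |w u|)
    (hT : ∀ t, |T t| ≤ A) (hw' : Summable fun x => |w' x|) (y : Site D) :
    Summable (fun p : Site D × Site D => w p.1 * T (y + p.1 - p.2) * w' p.2) := by
  have hA : 0 ≤ A := (abs_nonneg _).trans (hT 0)
  have hM : Summable (fun p : Site D × Site D => (|w p.1| * A) * |w' p.2|) :=
    (hw.mul_right A).mul_of_nonneg hw' (fun u => mul_nonneg (abs_nonneg _) hA) (fun x => abs_nonneg _)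
  refine Summable.of_norm_bounded hM (fun p => ?_)
  rw [Real.norm_eq_abs, abs_mul, abs_mul]
  exact mul_le_mul_of_nonneg_right (mul_le_mul_of_nonneg_left (hT _) (abs_nonneg _)) (abs_nonneg _)

/-- [folklore] LINEARITY of the dressed sum in the middle factor (summable fibres). -/
theorem dressedSum_sub {w T T' w' : Site D → ℝ} (y : Site D)
    (hT : Summable (fun p : Site D × Site D => w p.1 * T (y + p.1 - p.2) * w' p.2))
    (hT' : Summable (fun p : Site D × Site D => w p.1 * T' (y + p.1 - p.2) * w' p.2)) :
    dressedSum w (T - T') w' y = dressedSum w T w' y - dressedSum w T' w' y := by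
  unfold dressedSum
  rw [← hT.tsum_sub hT']
  refine tsum_congr (fun p => ?_)
  simp only [Pi.sub_apply]
  ring

/-- [folklore] The product family `(u, x) ↦ |w u| · |w' x|` is summable with sum `(Σ'|w|)·(Σ'|w'|)`. -/
theorem hasSum_abs_mul_abs {w w' : Site D → ℝ} (hw : Summable fun u => |w u|) (hw' : Summable fun x => |w' x|) :
    HasSum (fun p : Site D × Site D => |w p.1| * |w' p.2|) ((∑' u, |w u|) * (∑' x, |w' x|)) :=
  (hw.hasSum.mul hw'.hasSum) (hw.mul_of_nonneg hw' (fun _ => abs_nonneg _) (fun _ => abs_nonneg _))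

/-- [folklore] The product family `(u, x) ↦ w u · w' x` has the sum `(Σ'w)·(Σ'w')` (absolutely summable factors). -/
theorem hasSum_mul {w w' : Site D → ℝ} (hw : Summable fun u => |w u|) (hw' : Summable fun x => |w' x|) :
    HasSum (fun p : Site D × Site D => w p.1 * w' p.2) ((∑' u, w u) * (∑' x, w' x)) := by
  have hs : Summable (fun p : Site D × Site D => w p.1 * w' p.2) :=
    Summable.of_norm_bounded (hw.mul_of_nonneg hw' (fun _ => abs_nonneg _) (fun _ => abs_nonneg _)) (fun p => by
      rw [Real.norm_eq_abs, abs_mul])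
  exact (hw.of_abs.hasSum.mul hw'.of_abs.hasSum) hs

/-- [folklore] **THE CENTRED FORM**: `dressedSum w T w' y − T y·(Σ'w)(Σ'w') = Σ'_{(u,x)} w u·(T (y+u−x) − T y)·w' x`. -/
theorem dressedSum_sub_centre {w T w' : Site D → ℝ} {A : ℝ} (y : Site D) (hw : Summable fun u => |w u|)
    (hT : ∀ t, |T t| ≤ A) (hw' : Summable fun x => |w' x|) :
    dressedSum w T w' y - T y * ((∑' u, w u) * (∑' x, w' x))
      = ∑' p : Site D × Site D, w p.1 * (T (y + p.1 - p.2) - T y) * w' p.2 := by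
  have h1 := summable_dressed_fibre_of_bounded hw hT hw' y
  have h2 := ((hasSum_mul hw hw').mul_left (T y))
  unfold dressedSum
  rw [← h2.tsum_eq, ← h1.tsum_sub h2.summable]
  refine tsum_congr (fun p => ?_)
  ring


/-! ## §2 The unified near/far difference bound and the scalar transport comparison -/

/-- [folklore] The `ℓ¹` size of a lattice vector is the natural number `Σ_i |s_i|`. -/
theorem l1_eq_natCast (s : Site D) : l1 s = ((∑ i, (s i).natAbs : ℕ) : ℝ) := by
  unfold l1
  push_cast
  refine Finset.sum_congr rfl (fun i _ => ?_)
  rw [Nat.cast_natAbs]; push_cast; rfl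

/-- [folklore] Each coordinate is bounded by the natural number `Σ_i |s_i|`. -/
theorem abs_apply_le_sum_natAbs (s : Site D) (i : Fin D) : |s i| ≤ ((∑ j, (s j).natAbs : ℕ) : ℤ) := by
  rw [← Int.natCast_natAbs]
  exact_mod_cast Finset.single_le_sum (f := fun j => (s j).natAbs) (fun _ _ => Nat.zero_le _) (Finset.mem_univ i)

/-- [folklore] `(p + q)⁷ ≤ 2⁶·(p⁷ + q⁷)` for `p, q ≥ 0` (power mean). -/
theorem add_pow_seven_le {p q : ℝ} (hp : 0 ≤ p) (hq : 0 ≤ q) : (p + q) ^ 7 ≤ 64 * (p ^ 7 + q ^ 7) := by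
  have h := add_pow_le hp hq 7
  norm_num at h
  linarith

/-- **THE UNIFIED NEAR/FAR DIFFERENCE BOUND.**  `F` bounded by `A` everywhere and with first differences bounded by `B` on the coordinate
box of radius `ρ ≥ 1` around `y`; then for EVERY displacement `s`,
`|F (y + s) − F y| ≤ D·B·|s|₁ + 2A·(|s|₁/ρ)⁷` — the first summand controls the near region `|s|₁ ≤ ρ` (order-zero Taylor along the
coordinate path, `LatticeTaylorPath.abs_taylor0D_le`), the second the far region `|s|₁ > ρ` (where `(|s|₁/ρ)⁷ ≥ 1`). [folklore] -/
theorem abs_sub_le_near_far {F : Site D → ℝ} {y : Site D} {A B : ℝ} {ρ : ℕ} (hρ : 0 < ρ) (hB : 0 ≤ B)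
    (hA : ∀ t, |F t| ≤ A)
    (hF1 : ∀ t : Site D, (∀ i, |t i - y i| ≤ (ρ : ℤ)) → ∀ i, |F (t + Pi.single i 1) - F t| ≤ B)
    (s : Site D) :
    |F (y + s) - F y| ≤ (D : ℝ) * B * l1 s + 2 * A * (l1 s / ρ) ^ 7 := by
  have hA0 : 0 ≤ A := (abs_nonneg _).trans (hA y)
  have hl1 := l1_nonneg s
  have hRl1 : ((∑ i, (s i).natAbs : ℕ) : ℝ) = l1 s := (l1_eq_natCast s).symm
  by_cases hle : (∑ i, (s i).natAbs) ≤ ρ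
  · have h := abs_taylor0D_le F y s (abs_apply_le_sum_natAbs s) hB (fun x hx i =>
      hF1 x (fun j => (hx j).trans (by exact_mod_cast hle)) i)
    rw [hRl1] at h
    calc |F (y + s) - F y| ≤ (D : ℝ) * l1 s * B := h
      _ = (D : ℝ) * B * l1 s := by ring
      _ ≤ (D : ℝ) * B * l1 s + 2 * A * (l1 s / ρ) ^ 7 := le_add_of_nonneg_right (by positivity)
  · have hρ' : (0 : ℝ) < ρ := by exact_mod_cast hρ
    have h1 : |F (y + s) - F y| ≤ 2 * A := (abs_sub _ _).trans (by linarith [hA (y + s), hA y])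
    have h2 : (1 : ℝ) ≤ l1 s / ρ := by
      rw [le_div_iff₀ hρ', one_mul, ← hRl1]
      exact_mod_cast (not_le.mp hle).le
    calc |F (y + s) - F y| ≤ 2 * A := h1
      _ ≤ 2 * A * (l1 s / ρ) ^ 7 := le_mul_of_one_le_right (by positivity) (one_le_pow₀ h2)
      _ ≤ (D : ℝ) * B * l1 s + 2 * A * (l1 s / ρ) ^ 7 := le_add_of_nonneg_left (by positivity)

/-- [folklore] The weight-`(|u|₁+1)^k` family of a profile with summable weight-`(|u|₁+1)^7` family is summable for `k ≤ 7`. -/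
theorem summable_weight_of_le {w : Site D → ℝ} (hw : Summable fun u => (l1 u + 1) ^ 7 * |w u|) {k : ℕ} (hk : k ≤ 7) :
    Summable fun u => (l1 u + 1) ^ k * |w u| := by
  refine Summable.of_nonneg_of_le (fun u => mul_nonneg (pow_nonneg (by linarith [l1_nonneg u]) _) (abs_nonneg _))
    (fun u => ?_) hw
  have h1 : (1 : ℝ) ≤ l1 u + 1 := by linarith [l1_nonneg u]
  exact mul_le_mul_of_nonneg_right (pow_le_pow_right₀ h1 hk) (abs_nonneg _)

/-- [folklore] The difference bound at the displacement `u − x`, made monotone in the letters `|u|₁ + 1`, `|x|₁ + 1`: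
`|T (y + u − x) − T y| ≤ D·B·((|u|₁+1) + (|x|₁+1)) + 128·A·ρ⁻⁷·((|u|₁+1)⁷ + (|x|₁+1)⁷)`. -/
theorem abs_sub_le_letters {T : Site D → ℝ} {y : Site D} {A B : ℝ} {ρ : ℕ} (hρ : 0 < ρ) (hB : 0 ≤ B)
    (hA : ∀ t, |T t| ≤ A)
    (hT1 : ∀ t : Site D, (∀ i, |t i - y i| ≤ (ρ : ℤ)) → ∀ i, |T (t + Pi.single i 1) - T t| ≤ B) (u x : Site D) :
    |T (y + u - x) - T y|
      ≤ (D : ℝ) * B * ((l1 u + 1) + (l1 x + 1)) + 128 * A / (ρ : ℝ) ^ 7 * ((l1 u + 1) ^ 7 + (l1 x + 1) ^ 7) := by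
  have hA0 : 0 ≤ A := (abs_nonneg _).trans (hA y)
  have hρ' : (0 : ℝ) < ρ := by exact_mod_cast hρ
  have hs : l1 (u - x) ≤ (l1 u + 1) + (l1 x + 1) := by
    have t := l1_sub_triangle u 0 x
    rw [sub_zero, l1_sub_symm 0 x, sub_zero] at t
    linarith
  have hLu := l1_nonneg u
  have hLx := l1_nonneg x
  have h0 : 0 ≤ l1 (u - x) := l1_nonneg _
  have hd := abs_sub_le_near_far hρ hB hA hT1 (u - x)
  rw [show y + (u - x) = y + u - x by abel] at hd
  have hmono : (D : ℝ) * B * l1 (u - x) + 2 * A * (l1 (u - x) / ρ) ^ 7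
      ≤ (D : ℝ) * B * ((l1 u + 1) + (l1 x + 1)) + 2 * A * (((l1 u + 1) + (l1 x + 1)) / ρ) ^ 7 := by
    gcongr
  have hpow : (((l1 u + 1) + (l1 x + 1)) / ρ) ^ 7 ≤ 64 * ((l1 u + 1) ^ 7 + (l1 x + 1) ^ 7) / (ρ : ℝ) ^ 7 := by
    rw [div_pow]
    exact div_le_div_of_nonneg_right (add_pow_seven_le (by linarith) (by linarith)) (by positivity)
  have h3 : 2 * A * (((l1 u + 1) + (l1 x + 1)) / ρ) ^ 7 ≤ 2 * A * (64 * ((l1 u + 1) ^ 7 + (l1 x + 1) ^ 7) / (ρ : ℝ) ^ 7) :=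
    mul_le_mul_of_nonneg_left hpow (by positivity)
  have e : 2 * A * (64 * ((l1 u + 1) ^ 7 + (l1 x + 1) ^ 7) / (ρ : ℝ) ^ 7)
      = 128 * A / (ρ : ℝ) ^ 7 * ((l1 u + 1) ^ 7 + (l1 x + 1) ^ 7) := by ring
  linarith

/-- [folklore] THE MAJORANT FAMILY HAS THE EXPECTED SUM: with the letters `P_k := Σ'_u (|u|₁+1)^k|w u|`, `Q_k := Σ'_x (|x|₁+1)^k|w' x|`,
`Σ'_{(u,x)} |w u|·(β·((|u|₁+1)+(|x|₁+1)) + γ·((|u|₁+1)⁷+(|x|₁+1)⁷))·|w' x| = β·(P₁Q₀ + P₀Q₁) + γ·(P₇Q₀ + P₀Q₇)`. -/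
theorem hasSum_majorant {w w' : Site D → ℝ} (hw : Summable fun u => (l1 u + 1) ^ 7 * |w u|)
    (hw' : Summable fun x => (l1 x + 1) ^ 7 * |w' x|) (β γ : ℝ) :
    HasSum (fun p : Site D × Site D =>
        |w p.1| * (β * ((l1 p.1 + 1) + (l1 p.2 + 1)) + γ * ((l1 p.1 + 1) ^ 7 + (l1 p.2 + 1) ^ 7)) * |w' p.2|)
      (β * ((∑' u, (l1 u + 1) * |w u|) * (∑' x, |w' x|) + (∑' u, |w u|) * (∑' x, (l1 x + 1) * |w' x|))
        + γ * ((∑' u, (l1 u + 1) ^ 7 * |w u|) * (∑' x, |w' x|) + (∑' u, |w u|) * (∑' x, (l1 x + 1) ^ 7 * |w' x|))) := by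
  have hw0 : Summable fun u => |w u| := by simpa using summable_weight_of_le hw (k := 0) (by norm_num)
  have hw'0 : Summable fun x => |w' x| := by simpa using summable_weight_of_le hw' (k := 0) (by norm_num)
  have hw1 : Summable fun u => (l1 u + 1) * |w u| := by simpa using summable_weight_of_le hw (k := 1) (by norm_num)
  have hw'1 : Summable fun x => (l1 x + 1) * |w' x| := by simpa using summable_weight_of_le hw' (k := 1) (by norm_num)
  -- abstract the three letters of each pattern (keeps the unifier away from the powers)
  set f₀ : Site D → ℝ := fun u => |w u| with hf₀
  set f₁ : Site D → ℝ := fun u => (l1 u + 1) * |w u| with hf₁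
  set f₇ : Site D → ℝ := fun u => (l1 u + 1) ^ 7 * |w u| with hf₇
  set g₀ : Site D → ℝ := fun x => |w' x| with hg₀
  set g₁ : Site D → ℝ := fun x => (l1 x + 1) * |w' x| with hg₁
  set g₇ : Site D → ℝ := fun x => (l1 x + 1) ^ 7 * |w' x| with hg₇
  have n0 : 0 ≤ f₀ := fun u => abs_nonneg _
  have n1 : 0 ≤ f₁ := fun u => mul_nonneg (by linarith [l1_nonneg u]) (abs_nonneg _)
  have n7 : 0 ≤ f₇ := fun u => mul_nonneg (pow_nonneg (by linarith [l1_nonneg u]) _) (abs_nonneg _)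
  have m0 : 0 ≤ g₀ := fun x => abs_nonneg _
  have m1 : 0 ≤ g₁ := fun x => mul_nonneg (by linarith [l1_nonneg x]) (abs_nonneg _)
  have m7 : 0 ≤ g₇ := fun x => mul_nonneg (pow_nonneg (by linarith [l1_nonneg x]) _) (abs_nonneg _)
  have H10 : HasSum (fun p : Site D × Site D => f₁ p.1 * g₀ p.2) ((∑' u, f₁ u) * (∑' x, g₀ x)) :=
    (hw1.hasSum.mul hw'0.hasSum) (hw1.mul_of_nonneg hw'0 n1 m0)
  have H01 : HasSum (fun p : Site D × Site D => f₀ p.1 * g₁ p.2) ((∑' u, f₀ u) * (∑' x, g₁ x)) :=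
    (hw0.hasSum.mul hw'1.hasSum) (hw0.mul_of_nonneg hw'1 n0 m1)
  have H70 : HasSum (fun p : Site D × Site D => f₇ p.1 * g₀ p.2) ((∑' u, f₇ u) * (∑' x, g₀ x)) :=
    (hw.hasSum.mul hw'0.hasSum) (hw.mul_of_nonneg hw'0 n7 m0)
  have H07 : HasSum (fun p : Site D × Site D => f₀ p.1 * g₇ p.2) ((∑' u, f₀ u) * (∑' x, g₇ x)) :=
    (hw0.hasSum.mul hw'.hasSum) (hw0.mul_of_nonneg hw' n0 m7)
  have HM := ((H10.add H01).mul_left β).add ((H70.add H07).mul_left γ)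
  refine HM.congr_fun (fun p => ?_)
  simp only [hf₀, hf₁, hf₇, hg₀, hg₁, hg₇]
  ring

/-- **THE SCALAR TRANSPORT COMPARISON** (pointwise, at one output point `y`).  Middle factor `T` bounded by `A` with first differences
`≤ B` on the coordinate box of radius `ρ ≥ 1` around `y`; patterns `w, w'` with summable `(|·|₁+1)⁷`-weighted absolute families.  Then
`|dressedSum w T w' y − T y·(Σ'w)(Σ'w')| ≤ D·B·(P₁Q₀ + P₀Q₁) + 128·A·ρ⁻⁷·(P₇Q₀ + P₀Q₇)`, `P_k := Σ'_u (|u|₁+1)^k|w u|`,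
`Q_k := Σ'_x (|x|₁+1)^k|w' x|` — the profile LETTERS; no moment of `T` is used. [folklore] -/
theorem abs_dressedSum_sub_centre_le {w T w' : Site D → ℝ} {y : Site D} {A B : ℝ} {ρ : ℕ} (hρ : 0 < ρ) (hB : 0 ≤ B)
    (hA : ∀ t, |T t| ≤ A)
    (hT1 : ∀ t : Site D, (∀ i, |t i - y i| ≤ (ρ : ℤ)) → ∀ i, |T (t + Pi.single i 1) - T t| ≤ B)
    (hw : Summable fun u => (l1 u + 1) ^ 7 * |w u|) (hw' : Summable fun x => (l1 x + 1) ^ 7 * |w' x|) :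
    |dressedSum w T w' y - T y * ((∑' u, w u) * (∑' x, w' x))|
      ≤ (D : ℝ) * B * ((∑' u, (l1 u + 1) * |w u|) * (∑' x, |w' x|) + (∑' u, |w u|) * (∑' x, (l1 x + 1) * |w' x|))
        + 128 * A / (ρ : ℝ) ^ 7
          * ((∑' u, (l1 u + 1) ^ 7 * |w u|) * (∑' x, |w' x|) + (∑' u, |w u|) * (∑' x, (l1 x + 1) ^ 7 * |w' x|)) := by
  have hw0 : Summable fun u => |w u| := by simpa using summable_weight_of_le hw (k := 0) (by norm_num)
  have hw'0 : Summable fun x => |w' x| := by simpa using summable_weight_of_le hw' (k := 0) (by norm_num)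
  rw [dressedSum_sub_centre y hw0 hA hw'0]
  have h : ‖∑' p : Site D × Site D, w p.1 * (T (y + p.1 - p.2) - T y) * w' p.2‖ ≤ _ :=
    tsum_of_norm_bounded (hasSum_majorant hw hw' ((D : ℝ) * B) (128 * A / (ρ : ℝ) ^ 7)) (fun p => by
      rw [Real.norm_eq_abs, abs_mul, abs_mul]
      exact mul_le_mul_of_nonneg_right (mul_le_mul_of_nonneg_left (abs_sub_le_letters hρ hB hA hT1 p.1 p.2)
        (abs_nonneg _)) (abs_nonneg _))
  rw [Real.norm_eq_abs] at h
  exact h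


/-! ## §3 The profile letters of an exponentially localised pattern at the transport scale `a = δ/N` -/

/-- **THE `k`-TH LETTER AT SCALE `δ/N`**: `|w x| ≤ c·e^{−(δ/N)|x|₁}` (`δ > 0`, `N ≥ 1`, `c ≥ 0`) ⟹ the weight-`(|x|₁+1)^k` absolute family is
summable and `Σ'_x (|x|₁+1)^k·|w x| ≤ c·(k!·e^{δ/2}·(2/δ)^k·(1+4/δ)^D)·N^{k+D}` (`TransportProfileMoments.abs_tsum_le_elem` at `a = δ/N`, the
scale conversions of `letters_at_scale` for general `k`). [folklore] -/
theorem letter_at_scale {w : Site D → ℝ} {c δ : ℝ} {N : ℕ} (hδ : 0 < δ) (hN : 1 ≤ N) (hc : 0 ≤ c)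
    (hw : ∀ x, |w x| ≤ c * Real.exp (-(δ / N) * l1 x)) (k : ℕ) :
    Summable (fun x => (l1 x + 1) ^ k * |w x|)
      ∧ ∑' x, (l1 x + 1) ^ k * |w x| ≤ c * ((k.factorial : ℝ) * Real.exp (δ / 2) * (2 / δ) ^ k * (1 + 4 / δ) ^ D) * (N : ℝ) ^ (k + D) := by
  have hN' : (1 : ℝ) ≤ N := by exact_mod_cast hN
  have hNpos : (0 : ℝ) < N := by linarith
  have ha : 0 < δ / N := div_pos hδ hNpos
  have hwabs : ∀ x, |(fun x => |w x|) x| ≤ c * Real.exp (-(δ / N) * l1 x) := fun x => by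
    simp only [abs_abs]; exact hw x
  have hp : ∀ x : Site D, |(l1 x + 1) ^ k| ≤ (l1 x + 1) ^ k := fun x =>
    (abs_of_nonneg (pow_nonneg (by linarith [l1_nonneg x]) k)).le
  obtain ⟨hs, _⟩ := TransportProfileMoments.summable_and_abs_tsum_le (D := D) ha hc hwabs hp
  have hb := TransportProfileMoments.abs_tsum_le_elem (D := D) ha hc hwabs hp
  refine ⟨hs, ?_⟩
  have hnn : 0 ≤ ∑' x, (l1 x + 1) ^ k * |w x| :=
    tsum_nonneg fun x => mul_nonneg (pow_nonneg (by linarith [l1_nonneg x]) k) (abs_nonneg _)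
  rw [← abs_of_nonneg hnn]
  refine hb.trans ?_
  -- the scale conversions
  have hexp : Real.exp (δ / N / 2) ≤ Real.exp (δ / 2) := by
    apply Real.exp_le_exp.mpr
    rw [div_div, div_le_div_iff_of_pos_left hδ (by positivity) (by norm_num)]
    linarith
  have h2a : 2 / (δ / N) = 2 / δ * N := by field_simp
  have h4a : 1 + 4 / (δ / N) ≤ (1 + 4 / δ) * N := by
    rw [div_div_eq_mul_div, add_mul, one_mul]
    have : (0 : ℝ) ≤ 4 / δ * N := by positivity
    nlinarith [div_mul_eq_mul_div 4 δ (N : ℝ)]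
  have h4a0 : 0 ≤ 1 + 4 / (δ / N) := by positivity
  have hpowD : (1 + 4 / (δ / N)) ^ D ≤ (1 + 4 / δ) ^ D * (N : ℝ) ^ D := by
    rw [← mul_pow]; exact pow_le_pow_left₀ h4a0 h4a D
  rw [h2a, mul_pow]
  calc c * ((k.factorial : ℝ) * Real.exp (δ / N / 2) * ((2 / δ) ^ k * (N : ℝ) ^ k)) * (1 + 4 / (δ / N)) ^ D
      ≤ c * ((k.factorial : ℝ) * Real.exp (δ / 2) * ((2 / δ) ^ k * (N : ℝ) ^ k)) * ((1 + 4 / δ) ^ D * (N : ℝ) ^ D) := by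
        gcongr
    _ = c * ((k.factorial : ℝ) * Real.exp (δ / 2) * (2 / δ) ^ k * (1 + 4 / δ) ^ D) * (N : ℝ) ^ (k + D) := by
        rw [pow_add]; ring


/-! ## §4 `d = 4`: sup-norm geometry of the coarse point `N•v` and the TAIL KERNEL `K − truncK K N` -/

section Four

open DyadicShell (Pt supNorm natAbs_le_supNorm supNorm_le_iff exists_eq_supNorm corners mem_corners supNorm_le_supNorm_add_corner
  supNorm_eq_zero_iff)

/-- [folklore] `‖N•v‖∞ = N·‖v‖∞`. -/
theorem supNorm_natCast_smul (N : ℕ) (v : Pt) : supNorm ((N : ℤ) • v) = N * supNorm v := by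
  apply le_antisymm
  · rw [supNorm_le_iff]
    intro i
    rw [Pi.smul_apply, smul_eq_mul, Int.natAbs_mul, Int.natAbs_natCast]
    exact Nat.mul_le_mul_left _ (natAbs_le_supNorm v i)
  · obtain ⟨i, hi⟩ := exists_eq_supNorm v
    have h := natAbs_le_supNorm ((N : ℤ) • v) i
    rw [Pi.smul_apply, smul_eq_mul, Int.natAbs_mul, Int.natAbs_natCast, hi] at h
    exact h

/-- [folklore] Reverse triangle inequality on a coordinate box: `|t_i − y_i| ≤ ρ` for all `i` ⟹ `‖y‖∞ ≤ ‖t‖∞ + ρ`. -/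
theorem supNorm_le_add_of_box {t y : Pt} {ρ : ℕ} (h : ∀ i, |t i - y i| ≤ (ρ : ℤ)) : supNorm y ≤ supNorm t + ρ := by
  obtain ⟨i, hi⟩ := exists_eq_supNorm y
  have h1 := natAbs_le_supNorm t i
  have h2 := h i
  rw [abs_le] at h2
  rw [← hi]
  omega

/-- [folklore] The unit vector `e_i` is a corner (`{0,1}`-valued). -/
theorem single_mem_corners (i : Fin 4) : (Pi.single i (1 : ℤ) : Pt) ∈ corners := by
  rw [mem_corners]
  intro j
  by_cases h : j = i
  · subst h; right; simp
  · left; exact Pi.single_eq_of_ne h _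

/-- [folklore] THE TAIL KERNEL `K − truncK K N`: `0` on the core `‖t‖∞ ≤ N`, `K` beyond. -/
theorem tail_apply (K : EKer 4) (N : ℕ) (c e : Fin 4) (t : Pt) :
    (K - truncK K N) c e t = if supNorm t ≤ N then 0 else K c e t := by
  show K c e t - truncK K N c e t = _
  rw [truncK_apply]
  split_ifs <;> ring

/-- [folklore] Beyond the core the tail kernel IS `K`. -/
theorem tail_eq_of_lt {K : EKer 4} {N : ℕ} {t : Pt} (h : N < supNorm t) (c e : Fin 4) : (K - truncK K N) c e t = K c e t := by
  rw [tail_apply, if_neg (not_le.mpr h)]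

/-- [folklore] On the core the tail kernel vanishes. -/
theorem tail_eq_zero_of_le {K : EKer 4} {N : ℕ} {t : Pt} (h : supNorm t ≤ N) (c e : Fin 4) : (K - truncK K N) c e t = 0 := by
  rw [tail_apply, if_pos h]

/-- [folklore] The splitting `K = truncK K N + (K − truncK K N)`, entrywise. -/
theorem truncK_add_tail (K : EKer 4) (N : ℕ) (c e : Fin 4) (t : Pt) : truncK K N c e t + (K - truncK K N) c e t = K c e t := by
  show truncK K N c e t + (K c e t - truncK K N c e t) = K c e t
  ring

/-- [folklore] The decay constant of `|K| ≤ C·(‖·‖∞+1)⁻⁶` is nonnegative (read at `t = 0`). -/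
theorem nonneg_of_decay {K : EKer 4} {C : ℝ} (hK : ∀ c e (t : Pt), |K c e t| ≤ C / ((supNorm t : ℝ) + 1) ^ 6) (c e : Fin 4) : 0 ≤ C := by
  have h0 := hK c e 0
  rw [supNorm_eq_zero_iff.mpr rfl, Nat.cast_zero, zero_add, one_pow, div_one] at h0
  exact (abs_nonneg _).trans h0

/-- **THE TAIL IS UNIFORMLY SMALL**: `|K| ≤ C·(‖t‖∞+1)⁻⁶` ⟹ `|(K − truncK K N) c e t| ≤ C·(N+1)⁻⁶` for EVERY `t` — the reason the truncation
radius `N` makes the far-region contribution `N`-uniform. [folklore] -/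
theorem abs_tail_le {K : EKer 4} {C : ℝ} {N : ℕ} (hK : ∀ c e (t : Pt), |K c e t| ≤ C / ((supNorm t : ℝ) + 1) ^ 6)
    (c e : Fin 4) (t : Pt) : |(K - truncK K N) c e t| ≤ C / ((N : ℝ) + 1) ^ 6 := by
  have hC := nonneg_of_decay hK c e
  rw [tail_apply]
  split_ifs with h
  · rw [abs_zero]; positivity
  · refine (hK c e t).trans (div_le_div_of_nonneg_left hC (by positivity) ?_)
    have : (N : ℝ) + 1 ≤ (supNorm t : ℝ) + 1 := by
      have := (not_le.mp h).le
      exact_mod_cast Nat.add_le_add_right this 1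
    exact pow_le_pow_left₀ (by positivity) this 6

/-- **FIRST DIFFERENCES OF THE TAIL FAR FROM THE CORE** (`‖t‖∞ ≥ N + 2`, so that `t` and `t + e_i` are both beyond the core):
they are `K`'s, `≤ C·(‖t‖∞+1)⁻⁷`. [folklore] -/
theorem abs_tail_diff_le {K : EKer 4} {C : ℝ} {N : ℕ}
    (hdK : ∀ c e (t : Pt) (i : Fin 4), |K c e (t + Pi.single i 1) - K c e t| ≤ C / ((supNorm t : ℝ) + 1) ^ 7)
    {t : Pt} (ht : N + 2 ≤ supNorm t) (c e i : Fin 4) :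
    |(K - truncK K N) c e (t + Pi.single i 1) - (K - truncK K N) c e t| ≤ C / ((supNorm t : ℝ) + 1) ^ 7 := by
  have h1 : N < supNorm t := by omega
  have h2 : N < supNorm (t + Pi.single i 1) := by
    have := supNorm_le_supNorm_add_corner t (single_mem_corners i); omega
  rw [tail_eq_of_lt h1, tail_eq_of_lt h2]
  exact hdK c e t i

end Four

end Summit.QuantumFields.BalabanUV.Beta.FP.HorizontalBookkeepingTail

end
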